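import Summits.HodgeConjecture.HodgeConjecture.Theorems.F0P2oN3ClauseAOfDictionary          -- ★ p837285 (this seat): N3 ∕ clause (a) ⟸ the (E5) dictionary
import Summits.HodgeConjecture.HodgeConjecture.Theorems.F0P2oXiLocalPacketThetaPairOfLetters   -- ★ p829745 B-p14 (g27): the T7 composition `…_of_letters`
import Summits.HodgeConjecture.HodgeConjecture.Theorems.F0P2pK1wHolds                         -- ★ p833012 F0P2-p06 (g2): K1w hypothesis-free
import Summits.HodgeConjecture.HodgeConjecture.Theorems.F0P2pGR91NOfN3                        -- ★ p833094 F0P2-p06 (g2): U1 ∕ #76 ⟸ N3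
import Summits.HodgeConjecture.HodgeConjecture.Theorems.F0P2oThetaTypeNotL2                   -- ★ p831648 B-p18 (g28): LABEL ⟸ N3 N6 N7
import Summits.HodgeConjecture.HodgeConjecture.Theorems.F0P2oN7OfCasselmanCriterion           -- ★ p835805 A-p13 (g27): N7 hypothesis-free
import Summits.HodgeConjecture.HodgeConjecture.Theorems.F0P3KeysCaseTwoReducibleOfN3          -- ★ p835809 B-p14 (g28): #106 ⟸ N3
import Literature.NumberTheory.Automorphic.U3JacquetVanishingSupercuspidal                    -- ★ p831380 A-p16 (g23): N6 hypothesis-free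
import HarnessLib

/-!
# Crux `H413`, programme P2 — THE P2 LETTERS DOWNSTREAM OF N3, LINES-FREE: #104∕#75-loc (T7), #97 (U1), #76 (U′-N), #106 (Keys case two)
# from N3 ALONE, and from the (E5) dictionary statement ALONE

Cell hodgecm-mathlib (D-0151), FLOOR 0, crux item H413 = stmt-HodgeConjecture-24833, programme P2; seat F0P2-p02 (g7), self-placed S row (α′) after the lead's
row (α) (B-p18 (g29) 2026-08-31T23:08:02Z).  THEOREMS ONLY (compositions of ★ theorems; no `def`, no instance, no notation, no named fact, no `sorry`); no
`Cruxes/…/Lines` import (house rule O50-1); kernel lane `--supports stmt-HodgeConjecture-24833 --as helper`.  HC_CM is proved only modulo the 2 remaining named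
inputs (hLiu418, h413) — behind them the booked printed statements + the MOD package — until rung 0 closes; this file discharges no booked row by itself.

After tonight's folds the registered P2 Lines (T7 v1.5 `F0_P2XiLocalPacketThetaPair`, PKΠ v1.12, K1 v3e, parent v1.4) carry ONE local print residue,
`stub_N3a_letter` (clause (a) of ★ `GelbartRogawski1991.thetaType_nonsplit_jacquetModule`, #96), and every other local letter is closed BY NAME inside them.  Consumers
OUTSIDE those Lines files (the P3 closer's `stub_N3θ`∕`stub_N4`, T3b, T4, the gen-9 desk) need the same compositions as importable `Theorems/` constants.  This file
provides them with N3 as the ONLY hypothesis, and — through ★ p837285 `F0P2oN3ClauseAOfDictionary` — with F0P2-p01 (g8)'s (E5) dictionary statement as the only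
hypothesis, so that the minute `F0P2oLineWeilDictionary.exists_dictionary` is ★ every one of them is a one-token hypothesis-free theorem:

* `xiLocalPacket_nonsplit_isThetaPair_of_N3 (hN3)` — #104∕#75-loc [GelbartRogawski1991 Lem. 5.1.2, Cor. 5.2.2]: the T7 line's composition ★ p829745
  `xiLocalPacket_nonsplit_isThetaPair_of_letters` fed N3, ★ K1w p833012, ★ U1-of-N3 p833094, ★ N6 p831380, ★ LABEL p831648 over N3∕N6∕★ N7 p835805;
* `xiLocalPacket_nonsplit_isThetaPair_of_dictionary (hE5)`, `thetaType_nonsplit_jacquetModule_of_dictionary'` (re-export), `u1ThetaDichotomy_nonsplit_of_dictionary (hE5)`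
  (#97), `GR91Lemma512NonsplitAsPrinted_of_dictionary (hE5)` (#76), `keysCaseTwoReducible_of_dictionary (hE5) (L)` ∕ `keysCaseTwoReducible_closed_of_dictionary (hE5)` (#106).

## References
* [GelbartRogawski1991] S. Gelbart, J. Rogawski, Invent. Math. 105 (1991): §3.2 (3.2.1)–(3.2.3) p. 457; Lem. 5.1.2 p. 466; §5.2 Cor. 5.2.2 p. 467.
* [Rogawski1990] J. Rogawski, Ann. of Math. Stud. 123 (1990): §12.2 (2) pp. 173–174 (Keys case two).
* [Kudla1986] S. Kudla, Invent. Math. 83 (1986): Thm. 2.8.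
-/

set_option autoImplicit false
-- the mandated namespace repeats the single-problem summit's segment (`HodgeConjecture.HodgeConjecture`)
set_option linter.dupNamespace false

noncomputable section

open NumberField IsDedekindDomain MeasureTheory
open scoped Matrix Kronecker
open Literature.RepresentationTheory Literature.NumberTheory.Automorphic Representation
open Literature.NumberTheory Literature.NumberTheory.Automorphic.UnitaryGroup
open Literature.NumberTheory.Automorphic.IdeleClassGroup
open Literature.NumberTheory.Automorphic.Liu2021 Literature.NumberTheory.Automorphic.Liu2021.Def411WeilCarriers
open Literature.NumberTheory.GelbartRogawski1991 Literature.NumberTheory.GelbartRogawski1991.UnitaryDualPair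
open Literature.NumberTheory.GelbartRogawski1991.UnitaryDualPair.WeilCoinv Literature.NumberTheory.GelbartRogawski1991.UnitaryDualPair.LocalSplitting
open Literature.NumberTheory.GaloisRepresentations Literature.NumberTheory.Rogawski1990
open Literature.RepresentationTheory.Liu2021 Literature.RepresentationTheory.HeisenbergGroup
open Summit.HodgeConjecture.HodgeConjecture.Cruxes.H413

namespace Summit.HodgeConjecture.HodgeConjecture.Cruxes.H413.F0P2oLettersOfN3

/-! ## §1 From N3 alone -/

set_option synthInstance.maxHeartbeats 400000 in
set_option maxHeartbeats 8000000 in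
/-- **#104∕#75-loc `GelbartRogawski1991.xiLocalPacket_nonsplit_isThetaPair` FROM N3 ALONE** — the T7 line's registered composition (v1.5) at `Theorems/` level: ★
`xiLocalPacket_nonsplit_isThetaPair_of_letters` (p829745) fed `hN3`, ★ K1w (p833012, hypothesis-free), ★ U1 ⟸ N3 (p833094), ★ N6 (p831380, hypothesis-free) and
★ LABEL (p831648) over `hN3`, N6, ★ N7 (p835805, hypothesis-free). [cite: GelbartRogawski1991, Lem. 5.1.2 p. 466; §5.2 Cor. 5.2.2 p. 467] [cite: Rogawski1990, §12.2 (2) pp. 173–174] -/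
theorem xiLocalPacket_nonsplit_isThetaPair_of_N3 (hN3 : Literature.NumberTheory.GelbartRogawski1991.thetaType_nonsplit_jacquetModule) :
    Literature.NumberTheory.GelbartRogawski1991.xiLocalPacket_nonsplit_isThetaPair :=
  F0P2oXiLocalPacketThetaPairOfLetters.xiLocalPacket_nonsplit_isThetaPair_of_letters hN3
    F0P2pK1wHolds.cmPrincipalSeries_isConstituentOf_weylConj_holds
    (F0P2pGR91NOfN3.u1ThetaDichotomy_nonsplit_of_N3 hN3)
    Literature.NumberTheory.Rogawski1990.u3_isSupercuspidal_iff_jacquet_eq_zero_holds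
    (F0P2oThetaTypeNotL2.thetaType_not_squareIntegrable hN3 Literature.NumberTheory.Rogawski1990.u3_isSupercuspidal_iff_jacquet_eq_zero_holds
      F0P2oN7OfCasselmanCriterion.u3_squareIntegrable_jacquetExponent_decay_holds)

/-! ## §2 From the (E5) dictionary statement alone (★ p837285 `F0P2oN3ClauseAOfDictionary`) -/

set_option synthInstance.maxHeartbeats 400000 in
set_option maxHeartbeats 8000000 in
/-- **#104∕#75-loc FROM THE (E5) DICTIONARY** (§1 ∘ ★ p837285 `thetaType_nonsplit_jacquetModule_of_dictionary`). [cite: GelbartRogawski1991, Lem. 5.1.2 p. 466; §5.2 Cor. 5.2.2 p. 467] -/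
theorem xiLocalPacket_nonsplit_isThetaPair_of_dictionary
    (hE5 : ∀ (L : Type) [Field L] [NumberField L] [IsCMField L]
      {n' : ℕ} (e₁ : Fin 3 × Fin 1 ≃ Fin n') (dV : Fin 3 → L) (hdV : ∀ i, IsCMField.complexConj L (dV i) = dV i) (hdV0 : ∀ i, dV i ≠ 0)
      {n₀ : ℕ} (e₀ : Fin 1 × Fin 1 ≃ Fin n₀)
      (μ : Literature.NumberTheory.Automorphic.IdeleClassGroup L →ₜ* Circle) (hμ : IsConjugateSymplectic L μ)
      (ε : (↥(maximalRealSubfield L))ˣ) (v : HeightOneSpectrum (𝓞 ↥(maximalRealSubfield L))),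
      (∀ w : PlacesOver L v, IsCMField.complexConj L • w.1 = w.1) →
      ∀ (T : GL (Fin 3) (UnitaryGroup.LocalRing L v)) {a : UnitaryGroup.LocalRing L v} (ha : IsUnit a)
        (h : formCongr (conjLocal L (IsCMField.complexConj L) v) T ((Matrix.diagonal dV).map (algebraMap L (UnitaryGroup.LocalRing L v))) =
          a • (Matrix.of fun i j : Fin 3 => if i.val + j.val + 1 = 3 then (1 : L) else 0).map (algebraMap L (UnitaryGroup.LocalRing L v))),
      ∃ (π : SchwartzBruhat (Fin n' → v.adicCompletion ↥(maximalRealSubfield L)) →ₗ[ℂ]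
            SchwartzBruhat (Fin 1 → v.adicCompletion ↥(maximalRealSubfield L)))
        (σ : Representation ℂ (localPi L (IsCMField.complexConj L) 1 (JW (↥(maximalRealSubfield L)) L ε) v)
            (SchwartzBruhat (Fin 1 → v.adicCompletion ↥(maximalRealSubfield L))))
        (Tr : SchwartzBruhat (Fin 1 → v.adicCompletion ↥(maximalRealSubfield L)) ≃ₗ[ℂ]
            SchwartzBruhat (Fin n₀ → v.adicCompletion ↥(maximalRealSubfield L))),
        Function.Surjective π ∧
        LinearMap.ker π = Coinvariants.ker
          ((((MpPsi.toRep (localSchrodinger (↥(maximalRealSubfield L)) n'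
              (gram (↥(maximalRealSubfield L)) e₁ (realDiagonal L dV hdV) (TW (↥(maximalRealSubfield L)) ε)) v)).comp
            ((chiLocalSplittingsCM L e₁ dV hdV hdV0 (toHeckeCharacter L μ) ((isOscillatorChar_toHeckeCharacter_iff μ).mpr hμ) ε).s v)).comp
            ((localLineInl L (IsCMField.complexConj L) 3 e₁ (Matrix.diagonal dV) (JW (↥(maximalRealSubfield L)) L ε) v).comp
              ((localPiEquiv L (IsCMField.complexConj L) 3 (Matrix.diagonal dV) v).symm.toMonoidHom.comp
                (cmDatumLocalCongr L v T ha h).toMonoidHom))).comp (cmBorelTriple L 3 v).N.subtype) ∧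
        (∀ (u : localPi L (IsCMField.complexConj L) 1 (JW (↥(maximalRealSubfield L)) L ε) v)
          (f : SchwartzBruhat (Fin n' → v.adicCompletion ↥(maximalRealSubfield L))),
          π (MpPsi.toRep (localSchrodinger (↥(maximalRealSubfield L)) n'
              (gram (↥(maximalRealSubfield L)) e₁ (realDiagonal L dV hdV) (TW (↥(maximalRealSubfield L)) ε)) v)
            ((chiLocalSplittingsCM L e₁ dV hdV hdV0 (toHeckeCharacter L μ) ((isOscillatorChar_toHeckeCharacter_iff μ).mpr hμ) ε).s v
              (localCenter L (IsCMField.complexConj L) n' (Matrix.reindex e₁ e₁ (Matrix.diagonal dV ⊗ₖ JW (↥(maximalRealSubfield L)) L ε))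
                (JW (↥(maximalRealSubfield L)) L ε) (JW_apply_ne_zero (↥(maximalRealSubfield L)) L ε) v u)) f) = σ u (π f)) ∧
        ∀ (u : localPi L (IsCMField.complexConj L) 1 (JW (↥(maximalRealSubfield L)) L ε) v)
          (s : SchwartzBruhat (Fin 1 → v.adicCompletion ↥(maximalRealSubfield L))),
          lineWeilCM L e₀ (kernelLineCM dV) (complexConj_kernelLineCM dV hdV) (kernelLineCM_ne_zero dV hdV0) μ hμ ε v u (Tr s) =
            ((((toHeckeCharacter L μ).semilocalComponent L v
              ((localDet (IsCMField.complexConj L) v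
                (isUnit_iff_ne_zero.mpr (by rw [Matrix.det_fin_one]; exact JW_apply_ne_zero (↥(maximalRealSubfield L)) L ε))
                (localPiEquiv L (IsCMField.complexConj L) 1 (JW (↥(maximalRealSubfield L)) L ε) v u) :
                  ↥(normOneUnits (conjLocal L (IsCMField.complexConj L) v))) : (UnitaryGroup.LocalRing L v)ˣ))⁻¹ : ℂˣ) : ℂ) • Tr (σ u s)) :
    Literature.NumberTheory.GelbartRogawski1991.xiLocalPacket_nonsplit_isThetaPair :=
  xiLocalPacket_nonsplit_isThetaPair_of_N3 (F0P2oN3ClauseAOfDictionary.thetaType_nonsplit_jacquetModule_of_dictionary hE5)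

set_option synthInstance.maxHeartbeats 400000 in
set_option maxHeartbeats 8000000 in
/-- **#97 `GelbartRogawski1991.u1ThetaDichotomy_nonsplit` FROM THE (E5) DICTIONARY** (★ p833094 `u1ThetaDichotomy_nonsplit_of_N3` ∘ ★ p837285).
[cite: GelbartRogawski1991, Lem. 5.1.2 p. 466; §5.2 Cor. 5.2.2 p. 467] -/
theorem u1ThetaDichotomy_nonsplit_of_dictionary
    (hE5 : ∀ (L : Type) [Field L] [NumberField L] [IsCMField L]
      {n' : ℕ} (e₁ : Fin 3 × Fin 1 ≃ Fin n') (dV : Fin 3 → L) (hdV : ∀ i, IsCMField.complexConj L (dV i) = dV i) (hdV0 : ∀ i, dV i ≠ 0)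
      {n₀ : ℕ} (e₀ : Fin 1 × Fin 1 ≃ Fin n₀)
      (μ : Literature.NumberTheory.Automorphic.IdeleClassGroup L →ₜ* Circle) (hμ : IsConjugateSymplectic L μ)
      (ε : (↥(maximalRealSubfield L))ˣ) (v : HeightOneSpectrum (𝓞 ↥(maximalRealSubfield L))),
      (∀ w : PlacesOver L v, IsCMField.complexConj L • w.1 = w.1) →
      ∀ (T : GL (Fin 3) (UnitaryGroup.LocalRing L v)) {a : UnitaryGroup.LocalRing L v} (ha : IsUnit a)
        (h : formCongr (conjLocal L (IsCMField.complexConj L) v) T ((Matrix.diagonal dV).map (algebraMap L (UnitaryGroup.LocalRing L v))) =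
          a • (Matrix.of fun i j : Fin 3 => if i.val + j.val + 1 = 3 then (1 : L) else 0).map (algebraMap L (UnitaryGroup.LocalRing L v))),
      ∃ (π : SchwartzBruhat (Fin n' → v.adicCompletion ↥(maximalRealSubfield L)) →ₗ[ℂ]
            SchwartzBruhat (Fin 1 → v.adicCompletion ↥(maximalRealSubfield L)))
        (σ : Representation ℂ (localPi L (IsCMField.complexConj L) 1 (JW (↥(maximalRealSubfield L)) L ε) v)
            (SchwartzBruhat (Fin 1 → v.adicCompletion ↥(maximalRealSubfield L))))
        (Tr : SchwartzBruhat (Fin 1 → v.adicCompletion ↥(maximalRealSubfield L)) ≃ₗ[ℂ]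
            SchwartzBruhat (Fin n₀ → v.adicCompletion ↥(maximalRealSubfield L))),
        Function.Surjective π ∧
        LinearMap.ker π = Coinvariants.ker
          ((((MpPsi.toRep (localSchrodinger (↥(maximalRealSubfield L)) n'
              (gram (↥(maximalRealSubfield L)) e₁ (realDiagonal L dV hdV) (TW (↥(maximalRealSubfield L)) ε)) v)).comp
            ((chiLocalSplittingsCM L e₁ dV hdV hdV0 (toHeckeCharacter L μ) ((isOscillatorChar_toHeckeCharacter_iff μ).mpr hμ) ε).s v)).comp
            ((localLineInl L (IsCMField.complexConj L) 3 e₁ (Matrix.diagonal dV) (JW (↥(maximalRealSubfield L)) L ε) v).comp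
              ((localPiEquiv L (IsCMField.complexConj L) 3 (Matrix.diagonal dV) v).symm.toMonoidHom.comp
                (cmDatumLocalCongr L v T ha h).toMonoidHom))).comp (cmBorelTriple L 3 v).N.subtype) ∧
        (∀ (u : localPi L (IsCMField.complexConj L) 1 (JW (↥(maximalRealSubfield L)) L ε) v)
          (f : SchwartzBruhat (Fin n' → v.adicCompletion ↥(maximalRealSubfield L))),
          π (MpPsi.toRep (localSchrodinger (↥(maximalRealSubfield L)) n'
              (gram (↥(maximalRealSubfield L)) e₁ (realDiagonal L dV hdV) (TW (↥(maximalRealSubfield L)) ε)) v)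
            ((chiLocalSplittingsCM L e₁ dV hdV hdV0 (toHeckeCharacter L μ) ((isOscillatorChar_toHeckeCharacter_iff μ).mpr hμ) ε).s v
              (localCenter L (IsCMField.complexConj L) n' (Matrix.reindex e₁ e₁ (Matrix.diagonal dV ⊗ₖ JW (↥(maximalRealSubfield L)) L ε))
                (JW (↥(maximalRealSubfield L)) L ε) (JW_apply_ne_zero (↥(maximalRealSubfield L)) L ε) v u)) f) = σ u (π f)) ∧
        ∀ (u : localPi L (IsCMField.complexConj L) 1 (JW (↥(maximalRealSubfield L)) L ε) v)
          (s : SchwartzBruhat (Fin 1 → v.adicCompletion ↥(maximalRealSubfield L))),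
          lineWeilCM L e₀ (kernelLineCM dV) (complexConj_kernelLineCM dV hdV) (kernelLineCM_ne_zero dV hdV0) μ hμ ε v u (Tr s) =
            ((((toHeckeCharacter L μ).semilocalComponent L v
              ((localDet (IsCMField.complexConj L) v
                (isUnit_iff_ne_zero.mpr (by rw [Matrix.det_fin_one]; exact JW_apply_ne_zero (↥(maximalRealSubfield L)) L ε))
                (localPiEquiv L (IsCMField.complexConj L) 1 (JW (↥(maximalRealSubfield L)) L ε) v u) :
                  ↥(normOneUnits (conjLocal L (IsCMField.complexConj L) v))) : (UnitaryGroup.LocalRing L v)ˣ))⁻¹ : ℂˣ) : ℂ) • Tr (σ u s)) :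
    Literature.NumberTheory.GelbartRogawski1991.u1ThetaDichotomy_nonsplit :=
  F0P2pGR91NOfN3.u1ThetaDichotomy_nonsplit_of_N3 (F0P2oN3ClauseAOfDictionary.thetaType_nonsplit_jacquetModule_of_dictionary hE5)

set_option synthInstance.maxHeartbeats 400000 in
set_option maxHeartbeats 8000000 in
/-- **#76 U′-N `GelbartRogawski1991.GR91Lemma512NonsplitAsPrinted` FROM THE (E5) DICTIONARY** (★ p833094 `GR91Lemma512NonsplitAsPrinted_of_N3` ∘ ★ p837285).
[cite: GelbartRogawski1991, Lem. 5.1.2 p. 466] -/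
theorem GR91Lemma512NonsplitAsPrinted_of_dictionary
    (hE5 : ∀ (L : Type) [Field L] [NumberField L] [IsCMField L]
      {n' : ℕ} (e₁ : Fin 3 × Fin 1 ≃ Fin n') (dV : Fin 3 → L) (hdV : ∀ i, IsCMField.complexConj L (dV i) = dV i) (hdV0 : ∀ i, dV i ≠ 0)
      {n₀ : ℕ} (e₀ : Fin 1 × Fin 1 ≃ Fin n₀)
      (μ : Literature.NumberTheory.Automorphic.IdeleClassGroup L →ₜ* Circle) (hμ : IsConjugateSymplectic L μ)
      (ε : (↥(maximalRealSubfield L))ˣ) (v : HeightOneSpectrum (𝓞 ↥(maximalRealSubfield L))),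
      (∀ w : PlacesOver L v, IsCMField.complexConj L • w.1 = w.1) →
      ∀ (T : GL (Fin 3) (UnitaryGroup.LocalRing L v)) {a : UnitaryGroup.LocalRing L v} (ha : IsUnit a)
        (h : formCongr (conjLocal L (IsCMField.complexConj L) v) T ((Matrix.diagonal dV).map (algebraMap L (UnitaryGroup.LocalRing L v))) =
          a • (Matrix.of fun i j : Fin 3 => if i.val + j.val + 1 = 3 then (1 : L) else 0).map (algebraMap L (UnitaryGroup.LocalRing L v))),
      ∃ (π : SchwartzBruhat (Fin n' → v.adicCompletion ↥(maximalRealSubfield L)) →ₗ[ℂ]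
            SchwartzBruhat (Fin 1 → v.adicCompletion ↥(maximalRealSubfield L)))
        (σ : Representation ℂ (localPi L (IsCMField.complexConj L) 1 (JW (↥(maximalRealSubfield L)) L ε) v)
            (SchwartzBruhat (Fin 1 → v.adicCompletion ↥(maximalRealSubfield L))))
        (Tr : SchwartzBruhat (Fin 1 → v.adicCompletion ↥(maximalRealSubfield L)) ≃ₗ[ℂ]
            SchwartzBruhat (Fin n₀ → v.adicCompletion ↥(maximalRealSubfield L))),
        Function.Surjective π ∧
        LinearMap.ker π = Coinvariants.ker
          ((((MpPsi.toRep (localSchrodinger (↥(maximalRealSubfield L)) n'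
              (gram (↥(maximalRealSubfield L)) e₁ (realDiagonal L dV hdV) (TW (↥(maximalRealSubfield L)) ε)) v)).comp
            ((chiLocalSplittingsCM L e₁ dV hdV hdV0 (toHeckeCharacter L μ) ((isOscillatorChar_toHeckeCharacter_iff μ).mpr hμ) ε).s v)).comp
            ((localLineInl L (IsCMField.complexConj L) 3 e₁ (Matrix.diagonal dV) (JW (↥(maximalRealSubfield L)) L ε) v).comp
              ((localPiEquiv L (IsCMField.complexConj L) 3 (Matrix.diagonal dV) v).symm.toMonoidHom.comp
                (cmDatumLocalCongr L v T ha h).toMonoidHom))).comp (cmBorelTriple L 3 v).N.subtype) ∧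
        (∀ (u : localPi L (IsCMField.complexConj L) 1 (JW (↥(maximalRealSubfield L)) L ε) v)
          (f : SchwartzBruhat (Fin n' → v.adicCompletion ↥(maximalRealSubfield L))),
          π (MpPsi.toRep (localSchrodinger (↥(maximalRealSubfield L)) n'
              (gram (↥(maximalRealSubfield L)) e₁ (realDiagonal L dV hdV) (TW (↥(maximalRealSubfield L)) ε)) v)
            ((chiLocalSplittingsCM L e₁ dV hdV hdV0 (toHeckeCharacter L μ) ((isOscillatorChar_toHeckeCharacter_iff μ).mpr hμ) ε).s v
              (localCenter L (IsCMField.complexConj L) n' (Matrix.reindex e₁ e₁ (Matrix.diagonal dV ⊗ₖ JW (↥(maximalRealSubfield L)) L ε))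
                (JW (↥(maximalRealSubfield L)) L ε) (JW_apply_ne_zero (↥(maximalRealSubfield L)) L ε) v u)) f) = σ u (π f)) ∧
        ∀ (u : localPi L (IsCMField.complexConj L) 1 (JW (↥(maximalRealSubfield L)) L ε) v)
          (s : SchwartzBruhat (Fin 1 → v.adicCompletion ↥(maximalRealSubfield L))),
          lineWeilCM L e₀ (kernelLineCM dV) (complexConj_kernelLineCM dV hdV) (kernelLineCM_ne_zero dV hdV0) μ hμ ε v u (Tr s) =
            ((((toHeckeCharacter L μ).semilocalComponent L v
              ((localDet (IsCMField.complexConj L) v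
                (isUnit_iff_ne_zero.mpr (by rw [Matrix.det_fin_one]; exact JW_apply_ne_zero (↥(maximalRealSubfield L)) L ε))
                (localPiEquiv L (IsCMField.complexConj L) 1 (JW (↥(maximalRealSubfield L)) L ε) v u) :
                  ↥(normOneUnits (conjLocal L (IsCMField.complexConj L) v))) : (UnitaryGroup.LocalRing L v)ˣ))⁻¹ : ℂˣ) : ℂ) • Tr (σ u s)) :
    Literature.NumberTheory.GelbartRogawski1991.GR91Lemma512NonsplitAsPrinted :=
  F0P2pGR91NOfN3.GR91Lemma512NonsplitAsPrinted_of_N3 (F0P2oN3ClauseAOfDictionary.thetaType_nonsplit_jacquetModule_of_dictionary hE5)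

set_option synthInstance.maxHeartbeats 400000 in
set_option maxHeartbeats 8000000 in
/-- **#106 `Rogawski1990.KeysCaseTwoReducible L` FROM THE (E5) DICTIONARY** (★ p835809 `keysCaseTwoReducible_of_N3` ∘ ★ p837285), at one CM field `L`.
[cite: Rogawski1990, §12.2 (2) pp. 173–174] [cite: GelbartRogawski1991, Lem. 5.1.2 p. 466] -/
theorem keysCaseTwoReducible_of_dictionary
    (hE5 : ∀ (L : Type) [Field L] [NumberField L] [IsCMField L]
      {n' : ℕ} (e₁ : Fin 3 × Fin 1 ≃ Fin n') (dV : Fin 3 → L) (hdV : ∀ i, IsCMField.complexConj L (dV i) = dV i) (hdV0 : ∀ i, dV i ≠ 0)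
      {n₀ : ℕ} (e₀ : Fin 1 × Fin 1 ≃ Fin n₀)
      (μ : Literature.NumberTheory.Automorphic.IdeleClassGroup L →ₜ* Circle) (hμ : IsConjugateSymplectic L μ)
      (ε : (↥(maximalRealSubfield L))ˣ) (v : HeightOneSpectrum (𝓞 ↥(maximalRealSubfield L))),
      (∀ w : PlacesOver L v, IsCMField.complexConj L • w.1 = w.1) →
      ∀ (T : GL (Fin 3) (UnitaryGroup.LocalRing L v)) {a : UnitaryGroup.LocalRing L v} (ha : IsUnit a)
        (h : formCongr (conjLocal L (IsCMField.complexConj L) v) T ((Matrix.diagonal dV).map (algebraMap L (UnitaryGroup.LocalRing L v))) =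
          a • (Matrix.of fun i j : Fin 3 => if i.val + j.val + 1 = 3 then (1 : L) else 0).map (algebraMap L (UnitaryGroup.LocalRing L v))),
      ∃ (π : SchwartzBruhat (Fin n' → v.adicCompletion ↥(maximalRealSubfield L)) →ₗ[ℂ]
            SchwartzBruhat (Fin 1 → v.adicCompletion ↥(maximalRealSubfield L)))
        (σ : Representation ℂ (localPi L (IsCMField.complexConj L) 1 (JW (↥(maximalRealSubfield L)) L ε) v)
            (SchwartzBruhat (Fin 1 → v.adicCompletion ↥(maximalRealSubfield L))))
        (Tr : SchwartzBruhat (Fin 1 → v.adicCompletion ↥(maximalRealSubfield L)) ≃ₗ[ℂ]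
            SchwartzBruhat (Fin n₀ → v.adicCompletion ↥(maximalRealSubfield L))),
        Function.Surjective π ∧
        LinearMap.ker π = Coinvariants.ker
          ((((MpPsi.toRep (localSchrodinger (↥(maximalRealSubfield L)) n'
              (gram (↥(maximalRealSubfield L)) e₁ (realDiagonal L dV hdV) (TW (↥(maximalRealSubfield L)) ε)) v)).comp
            ((chiLocalSplittingsCM L e₁ dV hdV hdV0 (toHeckeCharacter L μ) ((isOscillatorChar_toHeckeCharacter_iff μ).mpr hμ) ε).s v)).comp
            ((localLineInl L (IsCMField.complexConj L) 3 e₁ (Matrix.diagonal dV) (JW (↥(maximalRealSubfield L)) L ε) v).comp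
              ((localPiEquiv L (IsCMField.complexConj L) 3 (Matrix.diagonal dV) v).symm.toMonoidHom.comp
                (cmDatumLocalCongr L v T ha h).toMonoidHom))).comp (cmBorelTriple L 3 v).N.subtype) ∧
        (∀ (u : localPi L (IsCMField.complexConj L) 1 (JW (↥(maximalRealSubfield L)) L ε) v)
          (f : SchwartzBruhat (Fin n' → v.adicCompletion ↥(maximalRealSubfield L))),
          π (MpPsi.toRep (localSchrodinger (↥(maximalRealSubfield L)) n'
              (gram (↥(maximalRealSubfield L)) e₁ (realDiagonal L dV hdV) (TW (↥(maximalRealSubfield L)) ε)) v)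
            ((chiLocalSplittingsCM L e₁ dV hdV hdV0 (toHeckeCharacter L μ) ((isOscillatorChar_toHeckeCharacter_iff μ).mpr hμ) ε).s v
              (localCenter L (IsCMField.complexConj L) n' (Matrix.reindex e₁ e₁ (Matrix.diagonal dV ⊗ₖ JW (↥(maximalRealSubfield L)) L ε))
                (JW (↥(maximalRealSubfield L)) L ε) (JW_apply_ne_zero (↥(maximalRealSubfield L)) L ε) v u)) f) = σ u (π f)) ∧
        ∀ (u : localPi L (IsCMField.complexConj L) 1 (JW (↥(maximalRealSubfield L)) L ε) v)
          (s : SchwartzBruhat (Fin 1 → v.adicCompletion ↥(maximalRealSubfield L))),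
          lineWeilCM L e₀ (kernelLineCM dV) (complexConj_kernelLineCM dV hdV) (kernelLineCM_ne_zero dV hdV0) μ hμ ε v u (Tr s) =
            ((((toHeckeCharacter L μ).semilocalComponent L v
              ((localDet (IsCMField.complexConj L) v
                (isUnit_iff_ne_zero.mpr (by rw [Matrix.det_fin_one]; exact JW_apply_ne_zero (↥(maximalRealSubfield L)) L ε))
                (localPiEquiv L (IsCMField.complexConj L) 1 (JW (↥(maximalRealSubfield L)) L ε) v u) :
                  ↥(normOneUnits (conjLocal L (IsCMField.complexConj L) v))) : (UnitaryGroup.LocalRing L v)ˣ))⁻¹ : ℂˣ) : ℂ) • Tr (σ u s))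
    (L : Type) [Field L] [NumberField L] [IsCMField L] :
    Literature.NumberTheory.Rogawski1990.KeysCaseTwoReducible L :=
  F0P3KeysCaseTwoReducibleOfN3.keysCaseTwoReducible_of_N3 L (F0P2oN3ClauseAOfDictionary.thetaType_nonsplit_jacquetModule_of_dictionary hE5)

set_option synthInstance.maxHeartbeats 400000 in
set_option maxHeartbeats 8000000 in
/-- **#106 ∀-closed over CM fields** (the closer's `stub_N4` ∕ T3b's `stub_keysCaseTwoReducible` binder shape, ★ p835809 `keysCaseTwoReducible_closed_of_N3` ∘ ★ p837285).
[cite: Rogawski1990, §12.2 (2) pp. 173–174] -/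
theorem keysCaseTwoReducible_closed_of_dictionary
    (hE5 : ∀ (L : Type) [Field L] [NumberField L] [IsCMField L]
      {n' : ℕ} (e₁ : Fin 3 × Fin 1 ≃ Fin n') (dV : Fin 3 → L) (hdV : ∀ i, IsCMField.complexConj L (dV i) = dV i) (hdV0 : ∀ i, dV i ≠ 0)
      {n₀ : ℕ} (e₀ : Fin 1 × Fin 1 ≃ Fin n₀)
      (μ : Literature.NumberTheory.Automorphic.IdeleClassGroup L →ₜ* Circle) (hμ : IsConjugateSymplectic L μ)
      (ε : (↥(maximalRealSubfield L))ˣ) (v : HeightOneSpectrum (𝓞 ↥(maximalRealSubfield L))),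
      (∀ w : PlacesOver L v, IsCMField.complexConj L • w.1 = w.1) →
      ∀ (T : GL (Fin 3) (UnitaryGroup.LocalRing L v)) {a : UnitaryGroup.LocalRing L v} (ha : IsUnit a)
        (h : formCongr (conjLocal L (IsCMField.complexConj L) v) T ((Matrix.diagonal dV).map (algebraMap L (UnitaryGroup.LocalRing L v))) =
          a • (Matrix.of fun i j : Fin 3 => if i.val + j.val + 1 = 3 then (1 : L) else 0).map (algebraMap L (UnitaryGroup.LocalRing L v))),
      ∃ (π : SchwartzBruhat (Fin n' → v.adicCompletion ↥(maximalRealSubfield L)) →ₗ[ℂ]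
            SchwartzBruhat (Fin 1 → v.adicCompletion ↥(maximalRealSubfield L)))
        (σ : Representation ℂ (localPi L (IsCMField.complexConj L) 1 (JW (↥(maximalRealSubfield L)) L ε) v)
            (SchwartzBruhat (Fin 1 → v.adicCompletion ↥(maximalRealSubfield L))))
        (Tr : SchwartzBruhat (Fin 1 → v.adicCompletion ↥(maximalRealSubfield L)) ≃ₗ[ℂ]
            SchwartzBruhat (Fin n₀ → v.adicCompletion ↥(maximalRealSubfield L))),
        Function.Surjective π ∧
        LinearMap.ker π = Coinvariants.ker
          ((((MpPsi.toRep (localSchrodinger (↥(maximalRealSubfield L)) n'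
              (gram (↥(maximalRealSubfield L)) e₁ (realDiagonal L dV hdV) (TW (↥(maximalRealSubfield L)) ε)) v)).comp
            ((chiLocalSplittingsCM L e₁ dV hdV hdV0 (toHeckeCharacter L μ) ((isOscillatorChar_toHeckeCharacter_iff μ).mpr hμ) ε).s v)).comp
            ((localLineInl L (IsCMField.complexConj L) 3 e₁ (Matrix.diagonal dV) (JW (↥(maximalRealSubfield L)) L ε) v).comp
              ((localPiEquiv L (IsCMField.complexConj L) 3 (Matrix.diagonal dV) v).symm.toMonoidHom.comp
                (cmDatumLocalCongr L v T ha h).toMonoidHom))).comp (cmBorelTriple L 3 v).N.subtype) ∧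
        (∀ (u : localPi L (IsCMField.complexConj L) 1 (JW (↥(maximalRealSubfield L)) L ε) v)
          (f : SchwartzBruhat (Fin n' → v.adicCompletion ↥(maximalRealSubfield L))),
          π (MpPsi.toRep (localSchrodinger (↥(maximalRealSubfield L)) n'
              (gram (↥(maximalRealSubfield L)) e₁ (realDiagonal L dV hdV) (TW (↥(maximalRealSubfield L)) ε)) v)
            ((chiLocalSplittingsCM L e₁ dV hdV hdV0 (toHeckeCharacter L μ) ((isOscillatorChar_toHeckeCharacter_iff μ).mpr hμ) ε).s v
              (localCenter L (IsCMField.complexConj L) n' (Matrix.reindex e₁ e₁ (Matrix.diagonal dV ⊗ₖ JW (↥(maximalRealSubfield L)) L ε))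
                (JW (↥(maximalRealSubfield L)) L ε) (JW_apply_ne_zero (↥(maximalRealSubfield L)) L ε) v u)) f) = σ u (π f)) ∧
        ∀ (u : localPi L (IsCMField.complexConj L) 1 (JW (↥(maximalRealSubfield L)) L ε) v)
          (s : SchwartzBruhat (Fin 1 → v.adicCompletion ↥(maximalRealSubfield L))),
          lineWeilCM L e₀ (kernelLineCM dV) (complexConj_kernelLineCM dV hdV) (kernelLineCM_ne_zero dV hdV0) μ hμ ε v u (Tr s) =
            ((((toHeckeCharacter L μ).semilocalComponent L v
              ((localDet (IsCMField.complexConj L) v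
                (isUnit_iff_ne_zero.mpr (by rw [Matrix.det_fin_one]; exact JW_apply_ne_zero (↥(maximalRealSubfield L)) L ε))
                (localPiEquiv L (IsCMField.complexConj L) 1 (JW (↥(maximalRealSubfield L)) L ε) v u) :
                  ↥(normOneUnits (conjLocal L (IsCMField.complexConj L) v))) : (UnitaryGroup.LocalRing L v)ˣ))⁻¹ : ℂˣ) : ℂ) • Tr (σ u s)) :
    ∀ (L : Type) [Field L] [NumberField L] [IsCMField L], Literature.NumberTheory.Rogawski1990.KeysCaseTwoReducible L :=
  F0P3KeysCaseTwoReducibleOfN3.keysCaseTwoReducible_closed_of_N3 (F0P2oN3ClauseAOfDictionary.thetaType_nonsplit_jacquetModule_of_dictionary hE5)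

end Summit.HodgeConjecture.HodgeConjecture.Cruxes.H413.F0P2oLettersOfN3

end
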